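import Summits.QuantumFields.BalabanUV.Beta.GAN24.DerivativeRateTransferJensenMassFreeConventionEnd

/-!
# `BalabanUV.Beta.GAN24.DerivativeRateTransferJensenMassFreeConventionLocal` — binder row G-an2-4 ∕ (CONV-C), route R6 «VALUES, NOT DERIVATIVES», PART 71:
# ONE CONVENTION SUFFICES — SUPPORT-LOCAL, IN PART 58 ∕ 62's LETTERS.  The loop letter of PARTs 61–64 constrains the open transports `τ(e′,x)` only at
# sites of POSITIVE WEIGHT (`q(src′e′,x) ≠ 0`; off the block the transports are unconstrained data).  THIS FILE takes the logarithms on the SUPPORT only: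
# base `τ₀(e′) := τ(e′,x₀(e′))` at a site of positive weight, `A(e′,x) = log(τ(e′,x)·τ₀(e′)ᵀ)` for `q(src′e′,x) ≠ 0` (PART 69), the (1.28) link
# `R″(e′) := exp(Σ_{q≠0} q(src′e′,x)·A(e′,x))·τ₀(e′)`, and proves PART 56's transfer letter `|(R″(e′) − R′(e′))w|² ≤ (20D_F³ + 784D_F⁴)²|w|²` against EVERY
# polar family `R′` given in PART 58 ∕ 62's letters (`hR′`, `hsym` in root-frame-defect form, `hPpsd`), `D_F = √(dim o)·D` from the POINTWISE loop letter
# (unit b2b-balaban-gan24-p3, gen 45; v1)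

NOT IN PRINT; OUR PROOF (for the ROUTE; PART 70 `polar_sub_expMeanLink_of_transports` on the support subtype + PART 58's `wsum_mul` bookkeeping BY NAME).
HONEST FRAMING (cell contract, verbatim): «discharging `BetaPertH` makes Bałaban's UV stability UNCONDITIONAL — a real constructive-QFT result; it is NOT
the continuum limit and NOT the Clay problem.»  HONEST DEPENDENCY (verbatim): «continuum YM on T⁴ ⇐ BetaPertH ∧ nine spine estimates (0/9 proved);
BetaPertH ⇐ (D1) ∧ (D4) ∧ CAP+tail; G-an2-4 gates asym, D1 and NE2/3/4.»

WHAT THIS FILE PROVES (0 sorry, 0 `def`, nothing cited):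
* §1 support bookkeeping: `sum_support_smul` (`Σ_{x : q x ≠ 0} q_x•g_x = Σ_x q_x•g_x`), `sum_support_weight` (`= 1`), `frob_loop_base_change`
  (`‖τ_xτ₀ᵀ − 1‖ = ‖τ₀ᵀτ_x − 1‖`), `polarLetters_of_defectLetters` (PART 58 ∕ 62's `hsym` ∕ `hPpsd` ⟹ `(Σ_x q_x•τ_x)·R′ᵀ` symmetric positive semidefinite).
* §2 **`polar_sub_expMeanLink_local`** (one coarse bond: ∃ skew logarithms on the support with `exp(A_x)·τ_{x₀} = τ_x`, `‖A_x‖ ≤ 2√(dim o)·D`; every polar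
  link is within `20D_F³ + 784D_F⁴` of `exp(Σ_{q≠0} q_x•A_x)·τ_{x₀}`), **`transferLetter_of_transports_local`** (bond-indexed, for ANY prescribed roots `x₀` of
  nonzero weight: ∃ `A`; for `R″` as above and EVERY polar family `R′` in PART 58 ∕ 62's letters, `∀ e′ w, |(R″e′ − R′e′)w|² ≤ (20D_F³ + 784D_F⁴)²|w|²` — PART 56's `hτ`).
WHAT IT DOES NOT DO: the transferred END itself (PART 72), anything of Bałaban's, (CONS) ∕ exact (STAB).  SUPPLIER work on route R6 (rank 2, REDUCTION, no
seat); no consumer of record; NEVER «G-an2-4 closed»; NOT (CONV-C), NOT D1, NOT `BetaPertH`, NOT continuum, NOT Clay.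
Records: `HOME/b2b-balaban-gan24-p3/WOODBURY-FIBRE.md` v14.5. -/

noncomputable section

open scoped Matrix Matrix.Norms.Frobenius
open NormedSpace Finset Matrix

namespace Summit.QuantumFields.BalabanUV.Beta.GAN24.DerivativeRateTransferJensenMassFreeConventionLocal

open Summit.QuantumFields.BalabanUV.Beta.GAN24.DerivativeRateTransferJensenMassFreePolarNear
open Summit.QuantumFields.BalabanUV.Beta.GAN24.DerivativeRateTransferJensenMassFreeLogarithm
open Summit.QuantumFields.BalabanUV.Beta.GAN24.DerivativeRateTransferJensenMassFreeConventionEnd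
open Summit.QuantumFields.BalabanUV.Beta.GAN24.DerivativeRateTransferJensenMassFreePolarFactor (wsum_mul)

variable {o ν : Type*} [Fintype o] [DecidableEq o] [Fintype ν]

/-! ## §1 Support bookkeeping -/

omit [Fintype o] [DecidableEq o] in
/-- `Σ_{x : q x ≠ 0} q_x•g_x = Σ_x q_x•g_x`. [folklore] -/
theorem sum_support_smul (q : ν → ℝ) (g : ν → Matrix o o ℝ) :
    ∑ x : {x : ν // q x ≠ 0}, q x • g x = ∑ x, q x • g x := by
  classical
  rw [← Finset.sum_subtype (Finset.univ.filter fun x => q x ≠ 0) (p := fun x => q x ≠ 0) (fun x => by simp) (f := fun x => q x • g x),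
    Finset.sum_filter]
  exact Finset.sum_congr rfl fun x _ => by
    by_cases h : q x = 0
    · simp [h]
    · simp [h]

omit [Fintype o] [DecidableEq o] in
/-- `Σ_{x : q x ≠ 0} q_x = Σ_x q_x`. [folklore] -/
theorem sum_support_weight (q : ν → ℝ) : ∑ x : {x : ν // q x ≠ 0}, q x = ∑ x, q x := by
  classical
  rw [← Finset.sum_subtype (Finset.univ.filter fun x => q x ≠ 0) (p := fun x => q x ≠ 0) (fun x => by simp) (f := fun x => q x),
    Finset.sum_filter]
  exact Finset.sum_congr rfl fun x _ => by
    by_cases h : q x = 0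
    · simp [h]
    · simp [h]

/-- base change of a loop in the Frobenius norm: `‖τ·τ₀ᵀ − 1‖ = ‖τ₀ᵀ·τ − 1‖` for orthogonal `τ₀`. [folklore] -/
theorem frob_loop_base_change {τ τ₀ : Matrix o o ℝ} (hτ₀ : τ₀ᵀ * τ₀ = 1) : ‖τ * τ₀ᵀ - 1‖ = ‖τ₀ᵀ * τ - 1‖ := by
  have hτ₀' : τ₀ * τ₀ᵀ = 1 := mul_eq_one_comm.mp hτ₀
  have e : τ * τ₀ᵀ - 1 = τ₀ * (τ₀ᵀ * τ - 1) * τ₀ᵀ := by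
    rw [Matrix.mul_sub, Matrix.sub_mul, Matrix.mul_one, hτ₀', ← Matrix.mul_assoc, hτ₀', Matrix.one_mul]
  rw [e, frob_norm_mul_orthogonal _ (by rw [transpose_transpose]; exact hτ₀), frob_norm_orthogonal_mul _ hτ₀]

/-- PART 58 ∕ 62's polar letters in defect form ⟹ the product form: if `Σ_x q_x = 1`, `(Σ_x q_x•(1 − τ_xR′ᵀ))ᵀ = Σ_x q_x•(1 − τ_xR′ᵀ)` and
`0 ≤ ⟨w, (Σ_x q_x•(τ_xR′ᵀ))w⟩` then `((Σ_x q_x•τ_x)·R′ᵀ)ᵀ = (Σ_x q_x•τ_x)·R′ᵀ` and `0 ≤ ⟨w, ((Σ_x q_x•τ_x)·R′ᵀ)w⟩`. [folklore] -/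
theorem polarLetters_of_defectLetters {q : ν → ℝ} (hq1 : ∑ x, q x = 1) {τ : ν → Matrix o o ℝ} {R' : Matrix o o ℝ}
    (hsym : (∑ x, q x • (1 - τ x * R'ᵀ))ᵀ = ∑ x, q x • (1 - τ x * R'ᵀ))
    (hPpsd : ∀ w : o → ℝ, 0 ≤ w ⬝ᵥ ((∑ x, q x • (τ x * R'ᵀ)) *ᵥ w)) :
    ((∑ x, q x • τ x) * R'ᵀ)ᵀ = (∑ x, q x • τ x) * R'ᵀ ∧ ∀ w : o → ℝ, 0 ≤ w ⬝ᵥ (((∑ x, q x • τ x) * R'ᵀ) *ᵥ w) := by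
  have e3 : ∑ x, q x • (τ x * R'ᵀ) = (∑ x, q x • τ x) * R'ᵀ := (wsum_mul q τ R'ᵀ).symm
  have e2 : ∑ x, q x • (1 - τ x * R'ᵀ) = 1 - (∑ x, q x • τ x) * R'ᵀ := by
    rw [← e3, Finset.sum_congr rfl fun x _ => smul_sub (q x) (1 : Matrix o o ℝ) _, Finset.sum_sub_distrib, ← Finset.sum_smul, hq1, one_smul]
  refine ⟨?_, fun w => ?_⟩
  · rw [e2, transpose_sub, transpose_one] at hsym
    have h := congrArg (fun X => (1 : Matrix o o ℝ) - X) hsym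
    simpa only [sub_sub_cancel] using h
  · rw [← e3]; exact hPpsd w

/-! ## §2 The transfer letter from the support-local loop letter -/

/-- **`polar_sub_expMeanLink_local` — ONE COARSE BOND** [our proof]: weights `q ≥ 0`, `Σq = 1`, orthogonal transports `τ_x`, a site `x₀` of positive
weight, the POINTWISE loop letter `|((τ_x)ᵀτ_{x′} − 1)w|² ≤ D²|w|²` for `q_x, q_{x′} ≠ 0` with `0 ≤ D`, `√(dim o)·D ≤ 1∕8` ⟹ ∃ skew `A : {x ∕∕ q x ≠ 0} → …`
with `exp(A_x)·τ_{x₀} = τ_x`, `‖A_x‖ ≤ 2√(dim o)·D`, and EVERY orthogonal `R′` with `(Σ_x q_x•τ_x)·R′ᵀ` symmetric positive semidefinite satisfies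
`‖R′ − exp(Σ_{x : q x ≠ 0} q_x•A_x)·τ_{x₀}‖ ≤ 20(√(dim o)D)³ + 784(√(dim o)D)⁴`. -/
theorem polar_sub_expMeanLink_local {q : ν → ℝ} (hq : ∀ x, 0 ≤ q x) (hq1 : ∑ x, q x = 1) {τ : ν → Matrix o o ℝ}
    (hτ : ∀ x, (τ x)ᵀ * τ x = 1) {x₀ : ν} (hx₀ : q x₀ ≠ 0) {D : ℝ} (hD0 : 0 ≤ D)
    (hloop : ∀ x x', q x ≠ 0 → q x' ≠ 0 → ∀ w : o → ℝ,
      ((((τ x)ᵀ * τ x') - 1) *ᵥ w) ⬝ᵥ ((((τ x)ᵀ * τ x') - 1) *ᵥ w) ≤ D ^ 2 * (w ⬝ᵥ w))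
    (hD8 : Real.sqrt (Fintype.card o) * D ≤ 1 / 8) :
    ∃ A : {x : ν // q x ≠ 0} → Matrix o o ℝ, (∀ x, (A x)ᵀ = -A x) ∧ (∀ x, exp (A x) * τ x₀ = τ x) ∧
      (∀ x, ‖A x‖ ≤ 2 * (Real.sqrt (Fintype.card o) * D)) ∧
      ∀ R' : Matrix o o ℝ, R'ᵀ * R' = 1 → ((∑ x, q x • τ x) * R'ᵀ)ᵀ = (∑ x, q x • τ x) * R'ᵀ →
        (∀ w : o → ℝ, 0 ≤ w ⬝ᵥ (((∑ x, q x • τ x) * R'ᵀ) *ᵥ w)) →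
        ‖R' - exp (∑ x : {x : ν // q x ≠ 0}, q x • A x) * τ x₀‖ ≤
          20 * (Real.sqrt (Fintype.card o) * D) ^ 3 + 784 * (Real.sqrt (Fintype.card o) * D) ^ 4 := by
  -- the support subtype carries the weights
  have hq' : ∀ x : {x : ν // q x ≠ 0}, 0 ≤ q x := fun x => hq x
  have hq1' : ∑ x : {x : ν // q x ≠ 0}, q x = 1 := by rw [sum_support_weight, hq1]
  have hτ' : ∀ x : {x : ν // q x ≠ 0}, (τ x)ᵀ * τ x = 1 := fun x => hτ x
  -- Frobenius loops against the base `τ_{x₀}`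
  have hD : ∀ x : {x : ν // q x ≠ 0}, ‖τ x * (τ x₀)ᵀ - 1‖ ≤ Real.sqrt (Fintype.card o) * D := fun x => by
    rw [frob_loop_base_change (hτ x₀)]
    exact frob_norm_le_sqrt_card_mul hD0 (hloop x₀ x hx₀ x.2)
  obtain ⟨A, hAt, hAe, hA2, hb⟩ := polar_sub_expMeanLink_of_transports hq' hq1' hτ' (hτ x₀) hD hD8
  refine ⟨A, hAt, hAe, hA2, fun R' hR' hsym hpsd => hb R' hR' ?_ ?_⟩
  · rw [sum_support_smul]; exact hsym
  · rw [sum_support_smul]; exact hpsd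

/-- **`transferLetter_of_transports_local` — PART 56's `hτ` FOR THE (1.28) LINKS, FROM THE SUPPORT-LOCAL LOOP LETTER** [our proof].  Bond-indexed data in
PART 58 ∕ 62's letters: weights `q(y,x) ≥ 0`, `Σ_x q(y,x) = 1`, orthogonal open transports `τ e′ x`, the POINTWISE loop letter for pairs of sites of
nonzero weight with `0 ≤ D`, `√(dim o)·D ≤ 1∕8`, and ANY prescribed roots `x₀ e′` of nonzero weight (print: the central contour).  THEN there are skew
logarithms `A e′ x` on the supports (`exp(A e′ x)·τ e′ (x₀ e′) = τ e′ x`, `‖A e′ x‖ ≤ 2√(dim o)·D`) such that, with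
`R″ e′ := exp(Σ_{q≠0} q(src′e′,x)•A e′ x)·τ e′ (x₀ e′)`, for EVERY family `R′` with `hR′` (orthogonal), `hsym` (`Σ_x q(src′e′,x)•(1 − τ e′ x·(R′e′)ᵀ)`
symmetric) and `hPpsd`: `∀ e′ w, |(R″e′ − R′e′)w|² ≤ (20D_F³ + 784D_F⁴)²|w|²`. -/
theorem transferLetter_of_transports_local {μ β' : Type*} {q : μ → ν → ℝ} (hq : ∀ y x, 0 ≤ q y x) (hq1 : ∀ y, ∑ x, q y x = 1)
    {src' : β' → μ} {τ : β' → ν → Matrix o o ℝ} (hτ : ∀ e' x, (τ e' x)ᵀ * τ e' x = 1) {D : ℝ} (hD0 : 0 ≤ D)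
    (hloop : ∀ e' x x', q (src' e') x ≠ 0 → q (src' e') x' ≠ 0 → ∀ w : o → ℝ,
      ((((τ e' x)ᵀ * τ e' x') - 1) *ᵥ w) ⬝ᵥ ((((τ e' x)ᵀ * τ e' x') - 1) *ᵥ w) ≤ D ^ 2 * (w ⬝ᵥ w))
    (hD8 : Real.sqrt (Fintype.card o) * D ≤ 1 / 8) {x₀ : β' → ν} (hx₀ : ∀ e', q (src' e') (x₀ e') ≠ 0) :
    ∃ A : ∀ e' : β', {x : ν // q (src' e') x ≠ 0} → Matrix o o ℝ,
      (∀ e' x, (A e' x)ᵀ = -A e' x) ∧ (∀ e' x, exp (A e' x) * τ e' (x₀ e') = τ e' x) ∧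
      (∀ e' x, ‖A e' x‖ ≤ 2 * (Real.sqrt (Fintype.card o) * D)) ∧
      ∀ R' : β' → Matrix o o ℝ, (∀ e', (R' e')ᵀ * R' e' = 1) →
        (∀ e', (∑ x, q (src' e') x • (1 - τ e' x * (R' e')ᵀ))ᵀ = ∑ x, q (src' e') x • (1 - τ e' x * (R' e')ᵀ)) →
        (∀ e' (w : o → ℝ), 0 ≤ w ⬝ᵥ ((∑ x, q (src' e') x • (τ e' x * (R' e')ᵀ)) *ᵥ w)) →
        ∀ e' (w : o → ℝ),
          ((exp (∑ x : {x : ν // q (src' e') x ≠ 0}, q (src' e') x • A e' x) * τ e' (x₀ e') - R' e') *ᵥ w) ⬝ᵥ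
              ((exp (∑ x : {x : ν // q (src' e') x ≠ 0}, q (src' e') x • A e' x) * τ e' (x₀ e') - R' e') *ᵥ w) ≤
            (20 * (Real.sqrt (Fintype.card o) * D) ^ 3 + 784 * (Real.sqrt (Fintype.card o) * D) ^ 4) ^ 2 * (w ⬝ᵥ w) := by
  have h : ∀ e', ∃ A : {x : ν // q (src' e') x ≠ 0} → Matrix o o ℝ, (∀ x, (A x)ᵀ = -A x) ∧ (∀ x, exp (A x) * τ e' (x₀ e') = τ e' x) ∧
      (∀ x, ‖A x‖ ≤ 2 * (Real.sqrt (Fintype.card o) * D)) ∧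
      ∀ R' : Matrix o o ℝ, R'ᵀ * R' = 1 → ((∑ x, q (src' e') x • τ e' x) * R'ᵀ)ᵀ = (∑ x, q (src' e') x • τ e' x) * R'ᵀ →
        (∀ w : o → ℝ, 0 ≤ w ⬝ᵥ (((∑ x, q (src' e') x • τ e' x) * R'ᵀ) *ᵥ w)) →
        ‖R' - exp (∑ x : {x : ν // q (src' e') x ≠ 0}, q (src' e') x • A x) * τ e' (x₀ e')‖ ≤
          20 * (Real.sqrt (Fintype.card o) * D) ^ 3 + 784 * (Real.sqrt (Fintype.card o) * D) ^ 4 := fun e' =>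
    polar_sub_expMeanLink_local (hq (src' e')) (hq1 (src' e')) (hτ e') (hx₀ e') hD0 (hloop e') hD8
  choose A hAt hAe hA2 hb using h
  refine ⟨A, hAt, hAe, hA2, fun R' hR' hsym hPpsd e' w => ?_⟩
  obtain ⟨hs, hp⟩ := polarLetters_of_defectLetters (hq1 (src' e')) (hsym e') (hPpsd e')
  have hbe := hb e' (R' e') (hR' e') hs hp
  rw [← norm_neg, neg_sub] at hbe
  refine (mulVec_dotProduct_self_le_frob _ w).trans (mul_le_mul_of_nonneg_right (pow_le_pow_left₀ (norm_nonneg _) hbe 2) ?_)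
  simpa only [dotProduct] using Finset.sum_nonneg fun i _ => mul_self_nonneg (w i)

end Summit.QuantumFields.BalabanUV.Beta.GAN24.DerivativeRateTransferJensenMassFreeConventionLocal
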